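import Summits.BirchSwinnertonDyer.BirchSwinnertonDyer.Theorems.CMKolyvaginAtInertTwoCMKolyvaginConjectureAtInertTwoFirstDescentWindowOnStubFrame
import Literature.NumberTheory.EllipticCurves.McCallum1991.KolyvaginLocalLeavesHolds
import HarnessLib

/-!
# Route `CMKolyvaginAtInertTwo`, crux `CMKolyvaginConjectureAtInertTwo` (stmt-BirchSwinnertonDyer-24648),
# stub `stub_positiveDepth` — census L1″ «ONE CURRENCY»: the obstruction class `s_ℓ = 2^{L−M₀}·c_L(e)` IS A
# `w(E)`-EIGEN SELMER CLASS of exact order `2^{M₀−m(ℓ)}`, so McCallum's first-descent window at `2` reads in the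
# single currency `Sel_{2^•}(E/K)^{w(E)}` on the stub's own frame

Seat `leafhand-bsd-cmkolyvaginatinert-8` g0 (cell `bsd-eis`); helper `--supports stmt-BirchSwinnertonDyer-24648`.
THEOREMS ONLY: no definition, no named fact introduced, no `sorry`; no stub, crux or summit closed; BSD proved for
no curve.  Hands 6/7 left the lower bound of the first descent (hand 6: the obstruction class `s_ℓ` of exact order
`2^{M₀−m(ℓ)}`, its image `š_ℓ ∈ Ш(E/K)`) and the upper bound (hand 7: `2^{M₀−m₁+1}·Sel_{2^M}(E/K)^{−ε} = 0`) «in two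
vocabularies» (census L1″).  This file shows they are ONE vocabulary already — `Sel_{2^•}(E/K)^{w(E)}` (`−ε = w(E)`):
* §1 `s_ℓ ∈ Sel_{2^L}(E/K)` is hand 5's `obstructionClass_mem_selmerGroup` (McCallum Lemma 4.3 / Prop. 4.4 at `2`),
  reused by name.
* §2 `conjAct_kolyvaginClass_eq_rootNumber_smul` / `conjAct_obstructionClass_eq_rootNumber_smul` — **Gross Prop. 5.4
  at `p = 2`, ONE prime: `c_* c_L(e) = w(E)·c_L(e)`** (sign `(−w)·(−1)^{1}`), hence `c_* s_ℓ = w(E)·s_ℓ`, for every datum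
  `e` of Zhang–Kolyvagin conductor `ℓ` of index `≥ L ≥ 1` on a frame with a conductor-`1` datum `d₁` — the tree's
  prime-generic sign law `McCallum1991.conjAct_kolyvaginClass_eq_sign_smul_zhang` with its inputs discharged AT `2`:
  admissibility `E(K[m])[2^L]`-freeness by `GenusKoly.isAdmissible_pointsSubgroup_two` (`ρ̄_{E,2}` onto, odd `d_K`,
  Heegner), Gross 5.3 by `McCallum1991.exists_mem_ringClassGal_isOfFinAddOrder_conj_sub_smul` (unconditional).
* §3 `exists_selmer_rootNumber_eigen_addOrderOf_eq_of_derivedPoint_one` — **the LOWER bound in the upper bound's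
  currency, on the frame of `stub_positiveDepth`** (+ Gross 3.7 (2) `h37` by name): a Zhang–Kolyvagin `ℓ` of index
  `≥ L ≥ M₀`, `2^{M₀} ∣ P(1)`, and a datum `e` with EXACT depth `m ≤ M₀` of `P_e(ℓ)` give
  `s ∈ Sel_{2^L}(E/K)` with `c_* s = w(E)·s` and `addOrderOf s = 2^{M₀−m}` (hand 6's `addOrderOf_obstructionClass`).
Together with `…FirstDescentWindowOnStubFrame` §1 (`2^{M₀−m₁+1}` kills `Sel_{2^M}(E/K)^{w(E)}` when every deep `P_e(ℓ)`
has a `2^{m₁}`-th root) this is McCallum's `N₁ = M₀ − M₁` at `p = 2` as a ONE-BIT window in ONE currency on ONE frame: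
`2^{M₀−M₁} ≤ exponent(Sel_{2^•}(E/K)^{w(E)}) ≤ 2^{M₀−M₁+1}` (`M₁ = min m(ℓ)` over deep `ℓ`; the lost bit is the
`E[2^M]^+ ⊕ E[2^M]^−` index of hand 7's file) — census item L1″ of hands 6/7, modulo nothing beyond their own inputs.

HONEST FRAMING.  §1–§2 are unconditional tree compositions (no named fact); §3 adds only Gross 3.7 (2) (`h37`, named
fact, as in hand 6).  The research core of the stub (a SOURCE of order-`≥ 4` classes in `Sel^{w(E)}`; the iteration
to `M_∞ = 0`) is untouched; no stub or crux is closed.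
References: [cite: GrossLMS1991, §5 Prop. 5.3, Prop. 5.4 (2), §4 (4.4)] [cite: McCallumLMS1991, §5 (the class d, Prop. 5.2,
Thm. 5.4)] [cite: SilvermanAEC2009, Thm. X.4.2 (a)] [cite: WZhang2014, Notations (xii)]
presearch: Gross 5.4 sign law in tree = `conjAct_kolyvaginClass_eq_sign_smul_zhang` (any `p`; the `_unconditional`
wrapper is `p ≠ 2` only because of its admissibility input) — reused by name with the `p = 2` admissibility of the
GenusKolyvaginAtTwo route; print = Gross 1991 Prop. 5.4 [corpus: book:editornd-l-functions-arithmetic, Gross §5].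
-/

set_option autoImplicit false
set_option linter.dupNamespace false -- the Theorems namespace repeats the summit name by design (D-0017)

noncomputable section
open scoped Classical
open Field NumberField IsDedekindDomain Function WeierstrassCurve
open Literature.NumberTheory.EllipticCurves
open Literature.NumberTheory.EllipticCurves.ModularForms
open Literature.NumberTheory.GaloisRepresentations
open Literature.NumberTheory.GaloisCohomology
open Literature.NumberTheory.EllipticCurves.GrossLMS1991 (prop37_2_reductionCongruence_inert)
open Summit.BirchSwinnertonDyer.Rank1Residual (X11b.KolyvaginAssembly.discr_lt_neg_four)

namespace Summit.BirchSwinnertonDyer.BirchSwinnertonDyer.Theorems.CMKolyvaginFirstDescentTwo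

variable (W : WeierstrassCurve ℚ) [W.IsElliptic] [W.IsGloballyMinimal] [NeZero (W.conductorNorm ℤ)]
  {K : Type} [Field K] [NumberField K]

/-! ## §1 The obstruction class is a Selmer class — hand 5's `obstructionClass_mem_selmerGroup` (reused by name) -/

/-! ## §2 Gross Prop. 5.4 at `p = 2` for one prime: `c_* c_L(e) = w(E)·c_L(e)` -/

/-- **Gross's Prop. 5.4 sign law at `p = 2`, one prime**: for `W` globally minimal with `ρ̄_{E,2}` onto, `K` imaginary
quadratic with odd `d_K ≠ −3` and the Heegner hypothesis for `N_E`, a conjugation `c ≠ 1`, a frame `(Dt, β, ι)` carrying a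
conductor-`1` datum `d₁`, a Zhang–Kolyvagin prime `ℓ` at `2` of index `≥ L ≥ 1` and ANY datum `e` of conductor `ℓ`:
`c_* c_L(e) = w(E)·c_L(e)` in `H¹(K, E[2^L])` — the sign `ε·(−1)^{#primes} = (−w(E))·(−1) = w(E)`.  The tree's
prime-generic `McCallum1991.conjAct_kolyvaginClass_eq_sign_smul_zhang` over the divisor family `{1 ↦ d₁, ℓ ↦ e}` with:
Gross 5.3 at `ε = −w(E)` from `McCallum1991.exists_mem_ringClassGal_isOfFinAddOrder_conj_sub_smul` (unconditional),
admissibility at `2` from `GenusKoly.isAdmissible_pointsSubgroup_two`, `d_K < −4` and `gcd(N_E, d_K) = 1` from the frame.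
[cite: GrossLMS1991, §5 Prop. 5.3, Prop. 5.4 (2)] [cite: McCallumLMS1991, §5 (p. 303)] -/
theorem conjAct_kolyvaginClass_eq_rootNumber_smul (hρ2 : W.HasSurjectiveModNGaloisRep 2)
    (hK : IsImaginaryQuadratic K) (hodd : Odd (NumberField.discr K)) (h3 : NumberField.discr K ≠ -3)
    (hHe : SatisfiesHeegnerHypothesis (W.conductorNorm ℤ) K) {c : K ≃ₐ[ℚ] K} (hc : c ≠ 1)
    (Dt : ModularParametrizationData W (W.conductorNorm ℤ)) (β : ℤ) (ι : K →+* ℂ)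
    (d₁ : KolyvaginHeegnerData Dt β ι 1) {L : ℕ} (hL : 1 ≤ L)
    {ℓ : ℕ} (hKol : Zhang2014.IsKolyvaginPrime (W.conductorNorm ℤ) W K 2 ℓ)
    (hidx : L ≤ Zhang2014.kolyvaginIndex W 2 ℓ) (e : KolyvaginHeegnerData Dt β ι ℓ) :
    conjAct W c ((2 ^ L : ℕ) : ℤ) (e.kolyvaginClass Nat.prime_two L) = W.rootNumber • e.kolyvaginClass Nat.prime_two L := by
  have hℓp : ℓ.Prime := hKol.1
  have h4 : NumberField.discr K ≠ -4 := fun h ↦ by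
    rw [h] at hodd
    exact (Int.not_even_iff_odd.mpr hodd) ⟨-2, by norm_num⟩
  have hD : NumberField.discr K < -4 := X11b.KolyvaginAssembly.discr_lt_neg_four hK ⟨h3, h4⟩
  have hsurj1 : W.HasSurjectiveModNGaloisRep ((2 : ℤ) ^ 1) := by simpa using hρ2
  have hND : IsCoprime ((W.conductorNorm ℤ : ℕ) : ℤ) (NumberField.discr K) :=
    GenusKoly.heegner_isCoprime_conductorNorm_discr hK hHe
  have hsq : Squarefree ℓ := hℓp.squarefree
  have hkol : ∀ q ∈ ℓ.primeFactors,
      Zhang2014.IsKolyvaginPrime (W.conductorNorm ℤ) W K 2 q ∧ L ≤ Zhang2014.kolyvaginIndex W 2 q := by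
    intro q hq
    rw [hℓp.primeFactors, Finset.mem_singleton] at hq
    subst hq
    exact ⟨hKol, hidx⟩
  -- the divisor family `{1 ↦ d₁, ℓ ↦ e}`
  have hℓ1 : ℓ ≠ 1 := hℓp.ne_one
  let data : (m : ℕ) → m ∣ ℓ → KolyvaginHeegnerData Dt β ι m := fun m hm ↦
    if h : m = ℓ then h ▸ e else ((Nat.dvd_prime hℓp).mp hm |>.resolve_right h) ▸ d₁
  have hdata : data ℓ dvd_rfl = e := by simp [data]
  -- Gross Prop. 5.3 at every divisor (unconditional in the tree), with `ε = −w(E)`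
  have h53 : ∀ (m : ℕ) (hm : m ∣ ℓ) (τm : ringClassField K ι m ≃ₐ[ℚ] ringClassField K ι m),
      (∀ x : ringClassField K ι m, ((τm x : ringClassField K ι m) : ℂ) = starRingEnd ℂ x) →
      ∃ σ' ∈ ringClassGal ι m, IsOfFinAddOrder
        (pointGalHom W (ringClassField K ι m) τm (data m hm).y -
          (-W.rootNumber) • pointGalHom W (ringClassField K ι m) σ' (data m hm).y) := by
    intro m hm τm hτm
    obtain ⟨hm0, hmN⟩ := McCallum1991.ne_zero_and_coprime_of_isKolyvaginPrime (K := K) (hsq.squarefree_of_dvd hm)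
      (fun q hq ↦ (hkol q (Nat.primeFactors_mono hm hℓp.ne_zero hq)).1)
    exact McCallum1991.exists_mem_ringClassGal_isOfFinAddOrder_conj_sub_smul W hK hHe Dt ι hm0 hmN (data m hm) τm hτm
  -- admissibility `E(K[m])[2^L] = 0`, `Γ_K`-stability, AT `2`
  have hA : ∀ (m : ℕ) (hm : m ∣ ℓ),
      KolyvaginCocycle.IsAdmissible (absoluteGaloisGroup K) (data m hm).pointsSubgroup ((2 ^ L : ℕ) : ℤ) :=
    fun m hm ↦ GenusKoly.isAdmissible_pointsSubgroup_two hK hodd hHe hsurj1 (ne_zero_of_dvd_ne_zero hℓp.ne_zero hm)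
      (data m hm) L
  have h := McCallum1991.conjAct_kolyvaginClass_eq_sign_smul_zhang (c := c) hK ι Nat.prime_two hL Dt hND hD hsq hkol
    data hc (-W.rootNumber) h53 hA ℓ dvd_rfl
  rw [hdata, hℓp.primeFactors, Finset.card_singleton, pow_one] at h
  rw [h]
  congr 1
  ring

/-- **`c_* s_ℓ = w(E)·s_ℓ`** for the obstruction class `s_ℓ = 2^{L−M₀}·c_L(e)` (same inputs as
`conjAct_kolyvaginClass_eq_rootNumber_smul`; `c_*` is additive). [cite: GrossLMS1991, §5 Prop. 5.4 (2)] -/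
theorem conjAct_obstructionClass_eq_rootNumber_smul (hρ2 : W.HasSurjectiveModNGaloisRep 2)
    (hK : IsImaginaryQuadratic K) (hodd : Odd (NumberField.discr K)) (h3 : NumberField.discr K ≠ -3)
    (hHe : SatisfiesHeegnerHypothesis (W.conductorNorm ℤ) K) {c : K ≃ₐ[ℚ] K} (hc : c ≠ 1)
    (Dt : ModularParametrizationData W (W.conductorNorm ℤ)) (β : ℤ) (ι : K →+* ℂ)
    (d₁ : KolyvaginHeegnerData Dt β ι 1) {M₀ L : ℕ} (hL : 1 ≤ L)
    {ℓ : ℕ} (hKol : Zhang2014.IsKolyvaginPrime (W.conductorNorm ℤ) W K 2 ℓ)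
    (hidx : L ≤ Zhang2014.kolyvaginIndex W 2 ℓ) (e : KolyvaginHeegnerData Dt β ι ℓ) :
    conjAct W c ((2 ^ L : ℕ) : ℤ) (((2 ^ (L - M₀) : ℕ) : ℤ) • e.kolyvaginClass Nat.prime_two L) =
      W.rootNumber • (((2 ^ (L - M₀) : ℕ) : ℤ) • e.kolyvaginClass Nat.prime_two L) := by
  rw [map_zsmul, conjAct_kolyvaginClass_eq_rootNumber_smul W hρ2 hK hodd h3 hHe hc Dt β ι d₁ hL hKol hidx e,
    smul_comm]

/-! ## §3 The lower bound in the currency `Sel_{2^L}(E/K)^{w(E)}`, on the stub's frame -/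

/-- **A `w(E)`-eigen Selmer class of EXACT order `2^{M₀−m(ℓ)}` from one deep prime, ON THE FRAME OF `stub_positiveDepth`**
(binders of the stub: `ρ̄_{E,2}` onto, odd Tamagawa; `K` imaginary quadratic, odd `d_K ≠ −3`, Heegner; `Dt, β, ι`, `d₁`;
plus Gross 3.7 (2) `h37` by name and a conjugation `c ≠ 1`): if `2^{M₀} ∣ P(1)` in `E(K[1])`, `1 ≤ M₀ ≤ L`, `ℓ` is a
Zhang–Kolyvagin prime at `2` of index `≥ L` and the datum `e` of conductor `ℓ` has EXACT depth `m ≤ M₀`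
(`2^m ∣ P_e(ℓ)`, `2^{m+1} ∤ P_e(ℓ)`), then `s_ℓ ∈ Sel_{2^L}(E/K)`, `c_* s_ℓ = w(E)·s_ℓ` and `addOrderOf s_ℓ = 2^{M₀−m}`
(hand 5's `obstructionClass_mem_selmerGroup`, §2, hand 6's `addOrderOf_obstructionClass`).  With `…FirstDescentWindowOnStubFrame` §1 this is the first-descent
window `2^{M₀−M₁} ≤ exponent(Sel^{w(E)}) ≤ 2^{M₀−M₁+1}` in ONE currency (census L1″).
[cite: McCallumLMS1991, §5 (the class d, Prop. 5.2, Thm. 5.4)] [cite: GrossLMS1991, §5 Prop. 5.4 (2)] -/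
theorem exists_selmer_rootNumber_eigen_addOrderOf_eq_of_derivedPoint_one (hρ2 : W.HasSurjectiveModNGaloisRep 2)
    (hT : Odd W.tamagawaProduct)
    (hK : IsImaginaryQuadratic K) (hodd : Odd (NumberField.discr K)) (h3 : NumberField.discr K ≠ -3)
    (hHe : SatisfiesHeegnerHypothesis (W.conductorNorm ℤ) K)
    (h37 : prop37_2_reductionCongruence_inert (W.conductorNorm ℤ) W K) {c : K ≃ₐ[ℚ] K} (hc : c ≠ 1)
    (Dt : ModularParametrizationData W (W.conductorNorm ℤ)) (β : ℤ) (ι : K →+* ℂ)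
    (d₁ : KolyvaginHeegnerData Dt β ι 1) {M₀ L m : ℕ} (hM₀ : 1 ≤ M₀) (hm : m ≤ M₀) (hML : M₀ ≤ L)
    (hdiv : ∃ Q : (W.baseChange (ringClassField K ι 1)).toAffine.Point, ((2 ^ M₀ : ℕ) : ℤ) • Q = d₁.derivedPoint)
    {ℓ : ℕ} (hKol : Zhang2014.IsKolyvaginPrime (W.conductorNorm ℤ) W K 2 ℓ)
    (hidx : L ≤ Zhang2014.kolyvaginIndex W 2 ℓ) (e : KolyvaginHeegnerData Dt β ι ℓ)
    (hdvd : ∃ Q : (W.baseChange (ringClassField K ι ℓ)).toAffine.Point, ((2 ^ m : ℕ) : ℤ) • Q = e.derivedPoint)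
    (hndvd : ¬ ∃ Q : (W.baseChange (ringClassField K ι ℓ)).toAffine.Point,
      ((2 ^ (m + 1) : ℕ) : ℤ) • Q = e.derivedPoint) :
    ∃ s ∈ selmerGroup (W.baseChange K) ((2 ^ L : ℕ) : ℤ),
      conjAct W c ((2 ^ L : ℕ) : ℤ) s = W.rootNumber • s ∧ addOrderOf s = 2 ^ (M₀ - m) :=
  ⟨_, (obstructionClass_mem_selmerGroup W hρ2 hT hK hodd h3 hHe h37 Dt β ι d₁ hML hdiv hKol hidx e).1,
    conjAct_obstructionClass_eq_rootNumber_smul W hρ2 hK hodd h3 hHe hc Dt β ι d₁ (hM₀.trans hML) hKol hidx e,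
    addOrderOf_obstructionClass W hρ2 hK hodd h3 hHe Dt β ι d₁ hm hML hKol hidx e hdvd hndvd⟩

end Summit.BirchSwinnertonDyer.BirchSwinnertonDyer.Theorems.CMKolyvaginFirstDescentTwo

end
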